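import Mathlib.Analysis.SpecificLimits.Basic
import Mathlib.Analysis.SpecialFunctions.Exp
import HarnessLib

/-!
# Line H (`BirthV10.stub_halvingStep`, stmt-QuantumFields-19200) — LEMMA B-al, (B-al-2) brick (iii): ★ THE PURE-REAL LEVEL RECURSION
# `ρ₀ = 0`, `ρ_{j+1} ≤ a·ρ_j + b·t^{k−1−j}`, `a·t < 1` ⇒ `ρ_k ≤ b·(1 − a·t)⁻¹` — and its B-al-2 instance
# `ρ_{j+1} ≤ L·ρ_j + C₁·(c·ε₀·L^{2(j+1)−2k})²` ⇒ `ρ_k ≤ (27∕26)·C₁·c²·ε₀²` (`L ≥ 3`), ABSOLUTE IN `k`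

Cell `ym3-torus` (HUMAN RULING D-0037: YM₃ on T³ is ladder rung R3 — NOT d = 4, NOT infinite volume, NOT a mass gap, NOT the Clay problem), width seat
`ym3-torus-px10` gen 4 (LEAD-H ★w5-19200 g7 WORD 10 (2): LEMMA B-al ≡ (N1); ★w3-19200 g10 SIGNATURE memo 67606d20 §1 (F3) ∕ §2 (B-al-2): «`ρ_{j+1} ≤ L·ρ_j + C₁(L²q_j)²`
… with LOCAL `δ_j`: `ρ_k ≤ Σ_j L^{k−1−j}·C₁·δ_j²` — geometric (ratio `L⁻³`), `ρ_k ≤ 2C₁(2(d−1))²ε₀² =: C_al·ε₀²`, ABSOLUTE»; ym-ust-20520-w3 g9 03:09:26Z: «(iii) would serve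
(B-al-4)₂'s sum too»).  `--supports stmt-QuantumFields-19200 --as helper`; THEOREMS ONLY (0 `def`, 0 `sorry`); count-neutral; nothing here claims B-al, `H42topCrossT`, (M2′),
the stub, the crux or the gap.

WHY.  (B-al-2) runs a level induction: the comb tower `C_j` and the pulled torus double-bar tower `D_j` of the pre-gauged ε₀-regular field satisfy `C_j = Φ_j·D_j·r_j`
with `‖r_j − 1‖ ≤ ρ_j`; one more averaging step costs a factor `L` (one-step Lipschitz of the double bar on multiplicative perturbations) plus the fresh one-step defect
`C₁·δ_j²` of (B-al-1), where the LOCAL expansion parameter is `δ_j = c·ε₀·L^{2(j+1−k)}` (memo (F3): `δ_j ≲ 2(d−1)L²·q_j`, `q_j = ε₀·L^{2(j−k)}`).  The resulting bound on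
`ρ_k` must be ABSOLUTE (independent of `k`) for the θ-row window of the (M2′) assembly to close (LEAD-H WORD 10 (3); ym-ust-20520-w3 g9 LOCATE adb4b732 §2 row
«`ε₀²·m·C_al` ✓ iff `C_al ≲ 10(dL−1)`»).  The (B-al-4)₂ k-step sum of ym-ust-20520-w3 g9 («pointwise, geometric, k-uniform») is the instance `a = 1`, `t = L⁻¹` of the
same recursion.  THIS FILE isolates that arithmetic, generic over `ℝ`, so that the analytic files consume it by name.
* §1 `recursion_geometric_source_invariant` ∕ ★ `recursion_geometric_source_le` — GENERIC: `ρ 0 = 0`, `ρ (j+1) ≤ a·ρ j + b·t^{k−1−j}` (`j < k`), `0 ≤ a, b, t`, `a·t < 1`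
  ⇒ `ρ i ≤ b·(1 − a·t)⁻¹·t^{k−i}` (`i ≤ k`) and `ρ k ≤ b·(1 − a·t)⁻¹`; `sum_geometric_level_le` — the `a = 1` case as a plain bound `ρ k ≤ b·(1 − t)⁻¹`;
* §2 `level_recursion_invariant` ∕ ★ `level_recursion_bound` — the B-al-2 instance (`a = L`, `t = L⁻⁴`, `b = C₁c²ε₀²`): `ρ k ≤ (27∕26)·C₁·c²·ε₀²` for `3 ≤ L`;
  `level_recursion_bound_two` — `ρ k ≤ (8∕7)·C₁·c²·ε₀²` for every `2 ≤ L`.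
* §3 `sum_geometric_source_le` ∕ ★ `gronwall_discrete` ∕ `gronwall_geometric_source_le` — VARIABLE COEFFICIENTS (the shape of ym-ust-20520-w3 g9's
  ✓`HalvingEffGaugeTowerRatio.norm_effGauge_ratio_le_of_pyramid` row `hE`, whose per-level amplification is `1 + η_j` with `η_j` small and summable, not a
  constant): `ρ (j+1) ≤ (1 + η j)·ρ j + s j`, `0 ≤ η, s, ρ 0` ⇒ `ρ k ≤ exp(Σ_{j<k} η j)·(ρ 0 + Σ_{j<k} s j)` (discrete Grönwall), the geometric source sum
  `Σ_{j<k} b·t^{k−1−j} ≤ b·(1 − t)⁻¹`, and the combination `ρ k ≤ exp(H)·(ρ 0 + b·(1 − t)⁻¹)` under `Σ_{j<k} η j ≤ H`.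
* §4 ★ `tower_of_step` ∕ `tower_of_step_geometric` — THE INDUCTION WRAPPER of (B-v) «TOWER»: for any level predicate `H : ℕ → ℝ → Prop` MONOTONE in its size
  argument, `H 0 0` and a STEP `∀ j < k, ∀ ρ, 0 ≤ ρ → H j ρ → H (j+1) (a·ρ + b·t^{k−1−j})` give `H k (b·(1 − a·t)⁻¹)` (`0 ≤ a, b, t`, `a·t < 1`) — so that (B-v) is
  «instantiate `H j ρ :=` ★w3-19200 g10's H_j text, feed (B-iv) as the step» with no arithmetic left to do.
HONEST SCOPE.  Pure real arithmetic and an induction on a monotone predicate (`L⁻³ ≤ 1∕27`, `1 + x ≤ exp x`); no lattice object appears; nothing of B-al's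
comparison, Lipschitz step or plaquette corollary is here.

References: T. Bałaban, CMP **98** (1985) 17–51 [Balaban1985Averaging] (Prop. 2–4, (42)–(51) pp.24–27: the averaged tower and its one-step bounds);
CMP **116** (1988) [Balaban1987RG1] ((0.3)–(0.4) pp.252–253: the double-bar averaging).
-/

set_option autoImplicit false

namespace Summit.QuantumFields.YangMills.Theorems.HalvingBalLevelRecursion

/-! ## §1 The generic recursion with a geometric source -/

/-- §1 **Closed-form invariant of a linear recursion with a geometric source counted from the top level.**  If `ρ 0 = 0` and
`ρ (j+1) ≤ a·ρ j + b·t^{k−1−j}` for all `j < k` (`0 ≤ a`, `0 ≤ b`, `0 ≤ t`, `a·t < 1`), then `ρ i ≤ b·(1 − a·t)⁻¹·t^{k−i}` for every `i ≤ k`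
(`ρ_i = b·t^{k−i}·Σ_{m<i}(a t)^m` summed in closed form).  (arithmetic core of the iterated one-step bounds of [Balaban1985Averaging] Prop. 2–4 as organised in
LEMMA B-al; no lattice content) [cite: Balaban1985Averaging, Prop. 4 (51) p.27] -/
theorem recursion_geometric_source_invariant {a b t : ℝ} (ha : 0 ≤ a) (hb : 0 ≤ b) (ht : 0 ≤ t) (hat : a * t < 1)
    (k : ℕ) (ρ : ℕ → ℝ) (h0 : ρ 0 = 0) (hstep : ∀ j, j < k → ρ (j + 1) ≤ a * ρ j + b * t ^ (k - (j + 1))) :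
    ∀ i, i ≤ k → ρ i ≤ b * (1 - a * t)⁻¹ * t ^ (k - i) := by
  have hB0 : 0 < 1 - a * t := sub_pos.mpr hat
  set B : ℝ := (1 - a * t)⁻¹ with hB_def
  have hBpos : 0 < B := inv_pos.mpr hB0
  -- the key identity of the invariant: `a·t·B + 1 = B`
  have hBkey : a * t * B + 1 = B := by
    have h1 : B * (1 - a * t) = 1 := inv_mul_cancel₀ hB0.ne'
    nlinarith [h1]
  intro i
  induction i with
  | zero =>
      intro _
      rw [h0]
      positivity
  | succ i ih =>
      intro hi
      have hi' : i < k := Nat.lt_of_succ_le hi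
      have hρi := ih hi'.le
      have hs := hstep i hi'
      have hki : k - i = (k - (i + 1)) + 1 := by omega
      set m : ℕ := k - (i + 1) with hm_def
      have htm0 : 0 ≤ t ^ m := pow_nonneg ht _
      calc ρ (i + 1) ≤ a * ρ i + b * t ^ m := hs
        _ ≤ a * (b * B * t ^ (k - i)) + b * t ^ m := by
            have := mul_le_mul_of_nonneg_left hρi ha
            linarith
        _ = b * B * t ^ m := by
            rw [hki, pow_succ]
            calc a * (b * B * (t ^ m * t)) + b * t ^ m = b * t ^ m * (a * t * B + 1) := by ring
              _ = b * t ^ m * B := by rw [hBkey]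
              _ = b * B * t ^ m := by ring

/-- §1 ★ **The recursion closes with a constant independent of the number of levels**: under the hypotheses of
`recursion_geometric_source_invariant`, `ρ k ≤ b·(1 − a·t)⁻¹`.  (B-al-2: `a = L`, `t = L⁻⁴`; (B-al-4)₂: `a = 1`, `t = L⁻¹`.)
[cite: Balaban1985Averaging, Prop. 4 (51) p.27] -/
theorem recursion_geometric_source_le {a b t : ℝ} (ha : 0 ≤ a) (hb : 0 ≤ b) (ht : 0 ≤ t) (hat : a * t < 1)
    (k : ℕ) (ρ : ℕ → ℝ) (h0 : ρ 0 = 0) (hstep : ∀ j, j < k → ρ (j + 1) ≤ a * ρ j + b * t ^ (k - (j + 1))) :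
    ρ k ≤ b * (1 - a * t)⁻¹ := by
  have h := recursion_geometric_source_invariant ha hb ht hat k ρ h0 hstep k le_rfl
  rwa [Nat.sub_self, pow_zero, mul_one] at h

/-- §1 The plain geometric level sum (`a = 1`): `ρ 0 = 0`, `ρ (j+1) ≤ ρ j + b·t^{k−1−j}` (`j < k`), `0 ≤ b`, `0 ≤ t < 1` ⇒ `ρ k ≤ b·(1 − t)⁻¹` —
the shape of a k-step sum of per-level contributions decaying geometrically towards the fine levels (ym-ust-20520-w3 g9's (B-al-4)₂ «pointwise, geometric,
k-uniform»). [cite: Balaban1985Averaging, Prop. 4 (51) p.27] -/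
theorem sum_geometric_level_le {b t : ℝ} (hb : 0 ≤ b) (ht : 0 ≤ t) (ht1 : t < 1)
    (k : ℕ) (ρ : ℕ → ℝ) (h0 : ρ 0 = 0) (hstep : ∀ j, j < k → ρ (j + 1) ≤ ρ j + b * t ^ (k - (j + 1))) :
    ρ k ≤ b * (1 - t)⁻¹ := by
  have h := recursion_geometric_source_le (a := 1) zero_le_one hb ht (by simpa using ht1) k ρ h0
    (fun j hj => by simpa using hstep j hj)
  simpa using h

/-! ## §2 The B-al-2 instance: factor `L` per step, source `C₁·(c·ε₀·L^{2(j+1)−2k})²` -/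

/-- §2 **The closed-form invariant of the (B-al-2) level recursion.**  If `ρ 0 = 0` and `ρ (j+1) ≤ L·ρ j + C₁·(c·ε₀·(L⁻¹)^{2(k−(j+1))})²` for all `j < k`
(`1 < L`, `0 ≤ C₁`), then for every `i ≤ k`: `ρ i ≤ C₁·c²·ε₀²·(1 − (L⁻¹)³)⁻¹·(L⁻¹)^{4(k−i)}` — §1 at `a = L`, `t = (L⁻¹)⁴`, `b = C₁c²ε₀²` (`a·t = (L⁻¹)³`).
[cite: Balaban1985Averaging, Prop. 4 (51) p.27] -/
theorem level_recursion_invariant {L C₁ c ε₀ : ℝ} (hL : 1 < L) (hC₁ : 0 ≤ C₁) (k : ℕ) (ρ : ℕ → ℝ) (h0 : ρ 0 = 0)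
    (hstep : ∀ j, j < k → ρ (j + 1) ≤ L * ρ j + C₁ * (c * ε₀ * (L⁻¹) ^ (2 * (k - (j + 1)))) ^ 2) :
    ∀ i, i ≤ k → ρ i ≤ C₁ * c ^ 2 * ε₀ ^ 2 * (1 - (L⁻¹) ^ 3)⁻¹ * (L⁻¹) ^ (4 * (k - i)) := by
  have hL0 : 0 < L := lt_trans zero_lt_one hL
  have hx0 : 0 ≤ L⁻¹ := inv_nonneg.mpr hL0.le
  have hx1 : L⁻¹ < 1 := inv_lt_one_of_one_lt₀ hL
  have hLx : L * L⁻¹ = 1 := mul_inv_cancel₀ hL0.ne'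
  have hat' : L * (L⁻¹) ^ 4 = (L⁻¹) ^ 3 := by
    calc L * (L⁻¹) ^ 4 = (L * L⁻¹) * (L⁻¹) ^ 3 := by ring
      _ = (L⁻¹) ^ 3 := by rw [hLx, one_mul]
  have hat : L * (L⁻¹) ^ 4 < 1 := by
    rw [hat']; exact pow_lt_one₀ hx0 hx1 (by norm_num)
  have hb : 0 ≤ C₁ * c ^ 2 * ε₀ ^ 2 := by positivity
  have hstep' : ∀ j, j < k → ρ (j + 1) ≤ L * ρ j + C₁ * c ^ 2 * ε₀ ^ 2 * ((L⁻¹) ^ 4) ^ (k - (j + 1)) := by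
    intro j hj
    have h := hstep j hj
    have hsq : C₁ * (c * ε₀ * (L⁻¹) ^ (2 * (k - (j + 1)))) ^ 2 = C₁ * c ^ 2 * ε₀ ^ 2 * ((L⁻¹) ^ 4) ^ (k - (j + 1)) := by
      rw [← pow_mul, show 4 * (k - (j + 1)) = 2 * (2 * (k - (j + 1))) by ring, pow_mul]
      ring
    linarith [hsq]
  intro i hi
  have h := recursion_geometric_source_invariant hL0.le hb (pow_nonneg hx0 4) hat k ρ h0 hstep' i hi
  rw [hat', ← pow_mul] at h
  exact h

/-- §2 ★ **The (B-al-2) level recursion closes with an ABSOLUTE constant**: `ρ 0 = 0`, `ρ (j+1) ≤ L·ρ j + C₁·(c·ε₀·(L⁻¹)^{2(k−(j+1))})²` (`j < k`), `3 ≤ L`,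
`0 ≤ C₁` ⇒ `ρ k ≤ (27∕26)·C₁·c²·ε₀²` — independent of the number of levels `k` (geometric ratio `L⁻³ ≤ 1∕27`).  This is the arithmetic behind
«`ρ_k ≤ C_al·ε₀²`, `C_al` ABSOLUTE» of LEMMA B-al (B-al-2); the analytic content (one-step Lipschitz + one-step defect) is NOT here.
[cite: Balaban1985Averaging, Prop. 4 (51) p.27] -/
theorem level_recursion_bound {L C₁ c ε₀ : ℝ} (hL : 3 ≤ L) (hC₁ : 0 ≤ C₁) (k : ℕ) (ρ : ℕ → ℝ) (h0 : ρ 0 = 0)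
    (hstep : ∀ j, j < k → ρ (j + 1) ≤ L * ρ j + C₁ * (c * ε₀ * (L⁻¹) ^ (2 * (k - (j + 1)))) ^ 2) :
    ρ k ≤ 27 / 26 * C₁ * c ^ 2 * ε₀ ^ 2 := by
  have hL1 : 1 < L := by linarith
  have hL0 : 0 < L := by linarith
  have hinv := level_recursion_invariant hL1 hC₁ k ρ h0 hstep k le_rfl
  rw [Nat.sub_self, mul_zero, pow_zero, mul_one] at hinv
  have hx0 : 0 ≤ L⁻¹ := inv_nonneg.mpr hL0.le
  have hx : L⁻¹ ≤ 1 / 3 := by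
    rw [one_div]; exact inv_anti₀ (by norm_num) hL
  have hx3 : (L⁻¹) ^ 3 ≤ 1 / 27 := by
    calc (L⁻¹) ^ 3 ≤ (1 / 3 : ℝ) ^ 3 := pow_le_pow_left₀ hx0 hx 3
      _ = 1 / 27 := by norm_num
  have hB : (1 - (L⁻¹) ^ 3)⁻¹ ≤ 27 / 26 := by
    have h26 : (26 : ℝ) / 27 ≤ 1 - (L⁻¹) ^ 3 := by linarith
    calc (1 - (L⁻¹) ^ 3)⁻¹ ≤ ((26 : ℝ) / 27)⁻¹ := inv_anti₀ (by norm_num) h26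
      _ = 27 / 26 := by norm_num
  have hK0 : 0 ≤ C₁ * c ^ 2 * ε₀ ^ 2 := by positivity
  calc ρ k ≤ C₁ * c ^ 2 * ε₀ ^ 2 * (1 - (L⁻¹) ^ 3)⁻¹ := hinv
    _ ≤ C₁ * c ^ 2 * ε₀ ^ 2 * (27 / 26) := mul_le_mul_of_nonneg_left hB hK0
    _ = 27 / 26 * C₁ * c ^ 2 * ε₀ ^ 2 := by ring

/-- §2′ The same recursion for every `2 ≤ L` (`L⁻³ ≤ 1∕8`): `ρ k ≤ (8∕7)·C₁·c²·ε₀²`, still independent of `k`.  (arithmetic variant of §2; same content)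
[cite: Balaban1985Averaging, Prop. 4 (51) p.27] -/
theorem level_recursion_bound_two {L C₁ c ε₀ : ℝ} (hL : 2 ≤ L) (hC₁ : 0 ≤ C₁) (k : ℕ) (ρ : ℕ → ℝ) (h0 : ρ 0 = 0)
    (hstep : ∀ j, j < k → ρ (j + 1) ≤ L * ρ j + C₁ * (c * ε₀ * (L⁻¹) ^ (2 * (k - (j + 1)))) ^ 2) :
    ρ k ≤ 8 / 7 * C₁ * c ^ 2 * ε₀ ^ 2 := by
  have hL1 : 1 < L := by linarith
  have hL0 : 0 < L := by linarith
  have hinv := level_recursion_invariant hL1 hC₁ k ρ h0 hstep k le_rfl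
  rw [Nat.sub_self, mul_zero, pow_zero, mul_one] at hinv
  have hx0 : 0 ≤ L⁻¹ := inv_nonneg.mpr hL0.le
  have hx : L⁻¹ ≤ 1 / 2 := by
    rw [one_div]; exact inv_anti₀ (by norm_num) hL
  have hx3 : (L⁻¹) ^ 3 ≤ 1 / 8 := by
    calc (L⁻¹) ^ 3 ≤ (1 / 2 : ℝ) ^ 3 := pow_le_pow_left₀ hx0 hx 3
      _ = 1 / 8 := by norm_num
  have hB : (1 - (L⁻¹) ^ 3)⁻¹ ≤ 8 / 7 := by
    have h7 : (7 : ℝ) / 8 ≤ 1 - (L⁻¹) ^ 3 := by linarith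
    calc (1 - (L⁻¹) ^ 3)⁻¹ ≤ ((7 : ℝ) / 8)⁻¹ := inv_anti₀ (by norm_num) h7
      _ = 8 / 7 := by norm_num
  have hK0 : 0 ≤ C₁ * c ^ 2 * ε₀ ^ 2 := by positivity
  calc ρ k ≤ C₁ * c ^ 2 * ε₀ ^ 2 * (1 - (L⁻¹) ^ 3)⁻¹ := hinv
    _ ≤ C₁ * c ^ 2 * ε₀ ^ 2 * (8 / 7) := mul_le_mul_of_nonneg_left hB hK0
    _ = 8 / 7 * C₁ * c ^ 2 * ε₀ ^ 2 := by ring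

/-! ## §3 Variable coefficients: discrete Grönwall and the geometric source sum -/

open Finset in
/-- §3 **The geometric source, summed**: `0 ≤ b`, `0 ≤ t < 1` ⇒ `Σ_{j<k} b·t^{k−1−j} ≤ b·(1 − t)⁻¹` — independent of `k` (the sum counted from the top level is a
truncated geometric series). (arithmetic; no lattice content) [cite: Balaban1985Averaging, Prop. 4 (51) p.27] -/
theorem sum_geometric_source_le {b t : ℝ} (hb : 0 ≤ b) (ht : 0 ≤ t) (ht1 : t < 1) (k : ℕ) :
    ∑ j ∈ range k, b * t ^ (k - (j + 1)) ≤ b * (1 - t)⁻¹ := by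
  have hrefl : ∑ j ∈ range k, b * t ^ (k - (j + 1)) = ∑ j ∈ range k, b * t ^ j := by
    rw [← Finset.sum_range_reflect (fun j => b * t ^ j) k]
    refine Finset.sum_congr rfl fun j hj => ?_
    have hj' := Finset.mem_range.mp hj
    congr 2; omega
  rw [hrefl, ← Finset.mul_sum]
  refine mul_le_mul_of_nonneg_left ?_ hb
  have hsum := hasSum_geometric_of_lt_one ht ht1
  exact sum_le_hasSum (range k) (fun i _ => pow_nonneg ht i) hsum

open Finset in
/-- §3 ★ **Discrete Grönwall with variable coefficients**: `0 ≤ ρ 0`, `ρ (j+1) ≤ (1 + η j)·ρ j + s j` with `0 ≤ η j`, `0 ≤ s j` for `j < k` ⇒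
`ρ k ≤ exp(Σ_{j<k} η j)·(ρ 0 + Σ_{j<k} s j)`.  When the per-level amplifications `η j` and the sources `s j` are summable uniformly in `k` (geometric towards the
fine levels), the bound is independent of the number of levels — the closed form a k-step tower induction with level-dependent small couplings consumes
(e.g. the dominating sequence `E` of ✓`HalvingEffGaugeTowerRatio.norm_effGauge_ratio_le_of_pyramid`). (arithmetic; no lattice content)
[cite: Balaban1985Averaging, (97)-(100) p.32] -/
theorem gronwall_discrete (η s ρ : ℕ → ℝ) (k : ℕ) (hη : ∀ j, j < k → 0 ≤ η j) (hs : ∀ j, j < k → 0 ≤ s j) (h0 : 0 ≤ ρ 0)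
    (hstep : ∀ j, j < k → ρ (j + 1) ≤ (1 + η j) * ρ j + s j) :
    ρ k ≤ Real.exp (∑ j ∈ range k, η j) * (ρ 0 + ∑ j ∈ range k, s j) := by
  -- invariant at every `i ≤ k`
  suffices h : ∀ i, i ≤ k → ρ i ≤ Real.exp (∑ j ∈ range i, η j) * (ρ 0 + ∑ j ∈ range i, s j) from h k le_rfl
  intro i
  induction i with
  | zero => intro _; simp
  | succ i ih =>
      intro hi
      have hi' : i < k := Nat.lt_of_succ_le hi
      have hρi := ih hi'.le
      have hηi := hη i hi'
      have hsi := hs i hi'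
      have hS0 : 0 ≤ ρ 0 + ∑ j ∈ range i, s j :=
        add_nonneg h0 (Finset.sum_nonneg fun j hj => hs j (lt_trans (Finset.mem_range.mp hj) hi'))
      have hexp0 : 0 ≤ Real.exp (∑ j ∈ range i, η j) := (Real.exp_pos _).le
      have hρi0 : 0 ≤ Real.exp (∑ j ∈ range i, η j) * (ρ 0 + ∑ j ∈ range i, s j) := mul_nonneg hexp0 hS0
      have h1η : 1 + η i ≤ Real.exp (η i) := by
        have := Real.add_one_le_exp (η i); linarith
      have h1η0 : 0 ≤ 1 + η i := by linarith
      have hexp1 : 1 ≤ Real.exp (∑ j ∈ range (i + 1), η j) :=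
        Real.one_le_exp (Finset.sum_nonneg fun j hj => hη j (lt_of_lt_of_le (Finset.mem_range.mp hj) hi))
      rw [Finset.sum_range_succ, Finset.sum_range_succ, Real.exp_add]
      calc ρ (i + 1) ≤ (1 + η i) * ρ i + s i := hstep i hi'
        _ ≤ (1 + η i) * (Real.exp (∑ j ∈ range i, η j) * (ρ 0 + ∑ j ∈ range i, s j)) + s i := by
            have := mul_le_mul_of_nonneg_left hρi h1η0; linarith
        _ ≤ Real.exp (η i) * (Real.exp (∑ j ∈ range i, η j) * (ρ 0 + ∑ j ∈ range i, s j)) + s i := by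
            have := mul_le_mul_of_nonneg_right h1η hρi0; linarith
        _ ≤ Real.exp (η i) * (Real.exp (∑ j ∈ range i, η j) * (ρ 0 + ∑ j ∈ range i, s j))
              + Real.exp (∑ j ∈ range i, η j) * Real.exp (η i) * s i := by
            have h2 : s i ≤ Real.exp (∑ j ∈ range i, η j) * Real.exp (η i) * s i := by
              have h3 : 1 ≤ Real.exp (∑ j ∈ range i, η j) * Real.exp (η i) := by
                rw [← Real.exp_add, ← Finset.sum_range_succ]; exact hexp1
              have := mul_le_mul_of_nonneg_right h3 hsi; linarith
            linarith
        _ = Real.exp (∑ j ∈ range i, η j) * Real.exp (η i) * (ρ 0 + (∑ j ∈ range i, s j + s i)) := by ring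

open Finset in
/-- §3 **Grönwall with a geometric source**: `0 ≤ ρ 0`, `ρ (j+1) ≤ (1 + η j)·ρ j + b·t^{k−1−j}` (`j < k`), `0 ≤ η j`, `Σ_{j<k} η j ≤ H`, `0 ≤ b`, `0 ≤ t < 1`
⇒ `ρ k ≤ exp(H)·(ρ 0 + b·(1 − t)⁻¹)` — independent of `k`. (`gronwall_discrete` ∘ `sum_geometric_source_le`; arithmetic, no lattice content)
[cite: Balaban1985Averaging, (97)-(100) p.32] -/
theorem gronwall_geometric_source_le (η ρ : ℕ → ℝ) (k : ℕ) {H b t : ℝ} (hη : ∀ j, j < k → 0 ≤ η j)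
    (hH : ∑ j ∈ range k, η j ≤ H) (hb : 0 ≤ b) (ht : 0 ≤ t) (ht1 : t < 1) (h0 : 0 ≤ ρ 0)
    (hstep : ∀ j, j < k → ρ (j + 1) ≤ (1 + η j) * ρ j + b * t ^ (k - (j + 1))) :
    ρ k ≤ Real.exp H * (ρ 0 + b * (1 - t)⁻¹) := by
  have hG := gronwall_discrete η (fun j => b * t ^ (k - (j + 1))) ρ k hη
    (fun j _ => mul_nonneg hb (pow_nonneg ht _)) h0 hstep
  have hsum := sum_geometric_source_le hb ht ht1 k
  have hexp : Real.exp (∑ j ∈ range k, η j) ≤ Real.exp H := Real.exp_le_exp.mpr hH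
  have hS0 : 0 ≤ ρ 0 + ∑ j ∈ range k, b * t ^ (k - (j + 1)) :=
    add_nonneg h0 (Finset.sum_nonneg fun j _ => mul_nonneg hb (pow_nonneg ht _))
  calc ρ k ≤ Real.exp (∑ j ∈ range k, η j) * (ρ 0 + ∑ j ∈ range k, b * t ^ (k - (j + 1))) := hG
    _ ≤ Real.exp H * (ρ 0 + ∑ j ∈ range k, b * t ^ (k - (j + 1))) := mul_le_mul_of_nonneg_right hexp hS0
    _ ≤ Real.exp H * (ρ 0 + b * (1 - t)⁻¹) := by
        refine mul_le_mul_of_nonneg_left ?_ (Real.exp_pos _).le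
        linarith

/-! ## §4 The induction wrapper of (B-v): a monotone level predicate driven by a STEP with geometric source -/

/-- §4 ★ **TOWER FROM STEP.**  `H : ℕ → ℝ → Prop` any level predicate, `H 0 0`, and a step
`∀ j < k, ∀ ρ ≥ 0, H j ρ → H (j+1) (a·ρ + b·t^{k−1−j})` (`0 ≤ a, b, t`) ⇒ for every `i ≤ k` there is `ρᵢ` with `0 ≤ ρᵢ ≤ b·(1 − a·t)⁻¹·t^{k−i}` and
`H i ρᵢ` — provided `a·t < 1`.  (the k-level induction of LEMMA B-al (B-v) with the arithmetic of §1 folded in; `H j ρ :=` «the comb tower and the pulled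
double-bar tower agree at level `j` up to `ρ`»; no lattice content here) [cite: Balaban1985Averaging, Prop. 4 (51) p.27] -/
theorem tower_of_step (H : ℕ → ℝ → Prop) {a b t : ℝ}
    (ha : 0 ≤ a) (hb : 0 ≤ b) (ht : 0 ≤ t) (hat : a * t < 1) (k : ℕ) (h0 : H 0 0)
    (hstep : ∀ j, j < k → ∀ ρ, 0 ≤ ρ → H j ρ → H (j + 1) (a * ρ + b * t ^ (k - (j + 1)))) :
    ∀ i, i ≤ k → ∃ ρ, 0 ≤ ρ ∧ ρ ≤ b * (1 - a * t)⁻¹ * t ^ (k - i) ∧ H i ρ := by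
  -- the canonical sequence `ρ 0 = 0`, `ρ (j+1) = a·ρ j + b·t^{k−1−j}` satisfies the step with equality
  let ρ : ℕ → ℝ := fun i => Nat.rec 0 (fun j r => a * r + b * t ^ (k - (j + 1))) i
  have hρ0 : ρ 0 = 0 := rfl
  have hρs : ∀ j, ρ (j + 1) = a * ρ j + b * t ^ (k - (j + 1)) := fun j => rfl
  have hρnn : ∀ i, 0 ≤ ρ i := by
    intro i
    induction i with
    | zero => exact le_of_eq hρ0.symm
    | succ j ih => rw [hρs]; positivity
  have hinv := recursion_geometric_source_invariant ha hb ht hat k ρ hρ0 (fun j _ => (hρs j).le)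
  have hH : ∀ i, i ≤ k → H i (ρ i) := by
    intro i
    induction i with
    | zero => intro _; rw [hρ0]; exact h0
    | succ j ih =>
        intro hj
        have hj' : j < k := Nat.lt_of_succ_le hj
        rw [hρs]
        exact hstep j hj' (ρ j) (hρnn j) (ih hj'.le)
  intro i hi
  exact ⟨ρ i, hρnn i, hinv i hi, hH i hi⟩

/-- §4 **TOWER FROM STEP, top level**: under the hypotheses of `tower_of_step`, `H k (b·(1 − a·t)⁻¹)` (by monotonicity from the canonical `ρ_k`).
(B-v)'s conclusion shape: «at the top level the two towers agree up to `C_Bal·ε₀²`», k-UNIFORM. [cite: Balaban1985Averaging, Prop. 4 (51) p.27] -/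
theorem tower_of_step_top (H : ℕ → ℝ → Prop) (hmono : ∀ j ρ ρ', H j ρ → ρ ≤ ρ' → H j ρ') {a b t : ℝ}
    (ha : 0 ≤ a) (hb : 0 ≤ b) (ht : 0 ≤ t) (hat : a * t < 1) (k : ℕ) (h0 : H 0 0)
    (hstep : ∀ j, j < k → ∀ ρ, 0 ≤ ρ → H j ρ → H (j + 1) (a * ρ + b * t ^ (k - (j + 1)))) :
    H k (b * (1 - a * t)⁻¹) := by
  obtain ⟨ρ, -, hρle, hH⟩ := tower_of_step H ha hb ht hat k h0 hstep k le_rfl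
  rw [Nat.sub_self, pow_zero, mul_one] at hρle
  exact hmono k ρ _ hH hρle

/-- §4 **Every level at once** (what a consumer reading the per-level sizes needs, e.g. (B-al-4)₂'s `hh j` rows): under the hypotheses of `tower_of_step`,
`H i (b·(1 − a·t)⁻¹·t^{k−i})` for every `i ≤ k` — the level-`i` agreement is itself geometrically small towards the fine levels.
[cite: Balaban1985Averaging, Prop. 4 (51) p.27] -/
theorem tower_of_step_level (H : ℕ → ℝ → Prop) (hmono : ∀ j ρ ρ', H j ρ → ρ ≤ ρ' → H j ρ') {a b t : ℝ}
    (ha : 0 ≤ a) (hb : 0 ≤ b) (ht : 0 ≤ t) (hat : a * t < 1) (k : ℕ) (h0 : H 0 0)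
    (hstep : ∀ j, j < k → ∀ ρ, 0 ≤ ρ → H j ρ → H (j + 1) (a * ρ + b * t ^ (k - (j + 1)))) :
    ∀ i, i ≤ k → H i (b * (1 - a * t)⁻¹ * t ^ (k - i)) := by
  intro i hi
  obtain ⟨ρ, -, hρle, hH⟩ := tower_of_step H ha hb ht hat k h0 hstep i hi
  exact hmono i ρ _ hH hρle

/-! ## §5 (v1.1) Nonzero initial datum: `ρ 0 = ρ₀ ≥ 0` — the shape of the ω-row's single-bar tower (`δ₀ ≤ L^{−k}c′`, `δ_{j+1} ≤ L·δ_j + dL²·q_j`) -/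

/-- §5 **Closed-form invariant with an initial datum.**  `0 ≤ ρ 0`, `ρ (j+1) ≤ a·ρ j + b·t^{k−1−j}` for `j < k` (`0 ≤ a, b, t`, `a·t < 1`) ⇒
`ρ i ≤ aⁱ·ρ 0 + b·(1 − a·t)⁻¹·t^{k−i}` for every `i ≤ k` — §1 applied to `ρ i − aⁱ·ρ 0`.  (ym-ust-20520-w3 g9's (F-ω) recursion: `a = L`, `t = L⁻²`,
`ρ 0 = δ₀ ≤ L^{−k}c′`, so `aᵏ·ρ 0 ≤ c′` and the source part is k-uniform; arithmetic only, no lattice content)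
[cite: Balaban1985Averaging, Prop. 4 p.38, (139)-(144) pp.39-40] -/
theorem recursion_geometric_source_init_invariant {a b t : ℝ} (ha : 0 ≤ a) (hb : 0 ≤ b) (ht : 0 ≤ t) (hat : a * t < 1)
    (k : ℕ) (ρ : ℕ → ℝ) (hstep : ∀ j, j < k → ρ (j + 1) ≤ a * ρ j + b * t ^ (k - (j + 1))) :
    ∀ i, i ≤ k → ρ i ≤ a ^ i * ρ 0 + b * (1 - a * t)⁻¹ * t ^ (k - i) := by
  have h := recursion_geometric_source_invariant ha hb ht hat k (fun i => ρ i - a ^ i * ρ 0) (by simp)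
    (fun j hj => by
      have hs := hstep j hj
      have : a * (ρ j - a ^ j * ρ 0) + b * t ^ (k - (j + 1)) = (a * ρ j + b * t ^ (k - (j + 1))) - a ^ (j + 1) * ρ 0 := by ring
      rw [this]
      linarith)
  intro i hi
  have hi' : ρ i - a ^ i * ρ 0 ≤ b * (1 - a * t)⁻¹ * t ^ (k - i) := h i hi
  linarith

/-- §5 ★ **Top level with an initial datum**: `ρ k ≤ aᵏ·ρ 0 + b·(1 − a·t)⁻¹`. [cite: Balaban1985Averaging, Prop. 4 p.38, (139)-(144) pp.39-40] -/
theorem recursion_geometric_source_init_le {a b t : ℝ} (ha : 0 ≤ a) (hb : 0 ≤ b) (ht : 0 ≤ t) (hat : a * t < 1)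
    (k : ℕ) (ρ : ℕ → ℝ) (hstep : ∀ j, j < k → ρ (j + 1) ≤ a * ρ j + b * t ^ (k - (j + 1))) :
    ρ k ≤ a ^ k * ρ 0 + b * (1 - a * t)⁻¹ := by
  have h := recursion_geometric_source_init_invariant ha hb ht hat k ρ hstep k le_rfl
  rwa [Nat.sub_self, pow_zero, mul_one] at h

/-- §5 **The initial datum measured from the top**: if moreover `ρ 0 ≤ c·(a⁻¹)^k` (`0 < a`; the ω-row's `δ₀ ≤ L^{−k}·c′`), then `ρ i ≤ c·(a⁻¹)^{k−i} + b·(1 − a·t)⁻¹·t^{k−i}`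
(`i ≤ k`) — both parts geometric towards the fine levels, k-UNIFORM at the top. [cite: Balaban1985Averaging, Prop. 4 p.38, (139)-(144) pp.39-40] -/
theorem recursion_geometric_source_init_level {a b t c : ℝ} (ha : 0 < a) (hb : 0 ≤ b) (ht : 0 ≤ t) (hat : a * t < 1)
    (k : ℕ) (ρ : ℕ → ℝ) (h0 : ρ 0 ≤ c * (a⁻¹) ^ k) (hstep : ∀ j, j < k → ρ (j + 1) ≤ a * ρ j + b * t ^ (k - (j + 1))) :
    ∀ i, i ≤ k → ρ i ≤ c * (a⁻¹) ^ (k - i) + b * (1 - a * t)⁻¹ * t ^ (k - i) := by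
  intro i hi
  have h := recursion_geometric_source_init_invariant ha.le hb ht hat k ρ hstep i hi
  have hai : 0 ≤ a ^ i := pow_nonneg ha.le i
  have h1 : a ^ i * ρ 0 ≤ c * (a⁻¹) ^ (k - i) := by
    calc a ^ i * ρ 0 ≤ a ^ i * (c * (a⁻¹) ^ k) := mul_le_mul_of_nonneg_left h0 hai
      _ = c * (a ^ i * (a⁻¹) ^ i) * (a⁻¹) ^ (k - i) := by
          rw [show (a⁻¹) ^ k = (a⁻¹) ^ i * (a⁻¹) ^ (k - i) by rw [← pow_add]; congr 1; omega]
          ring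
      _ = c * (a⁻¹) ^ (k - i) := by rw [← mul_pow, mul_inv_cancel₀ ha.ne', one_pow, mul_one]
  linarith

/-- §5 ★ **TOWER FROM STEP with an initial datum** (the ω-row's induction wrapper): `H : ℕ → ℝ → Prop` any level predicate MONOTONE in the size, `H 0 ρ₀` with
`0 ≤ ρ₀`, STEP `∀ j < k, ∀ ρ ≥ 0, H j ρ → H (j+1) (a·ρ + b·t^{k−1−j})` (`0 ≤ a, b, t`, `a·t < 1`) ⇒ `H i (aⁱ·ρ₀ + b·(1 − a·t)⁻¹·t^{k−i})` for every `i ≤ k`.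
[cite: Balaban1985Averaging, Prop. 4 p.38, (139)-(144) pp.39-40] -/
theorem tower_of_step_init_level (H : ℕ → ℝ → Prop) (hmono : ∀ j ρ ρ', H j ρ → ρ ≤ ρ' → H j ρ') {a b t ρ₀ : ℝ}
    (ha : 0 ≤ a) (hb : 0 ≤ b) (ht : 0 ≤ t) (hat : a * t < 1) (hρ₀ : 0 ≤ ρ₀) (k : ℕ) (h0 : H 0 ρ₀)
    (hstep : ∀ j, j < k → ∀ ρ, 0 ≤ ρ → H j ρ → H (j + 1) (a * ρ + b * t ^ (k - (j + 1)))) :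
    ∀ i, i ≤ k → H i (a ^ i * ρ₀ + b * (1 - a * t)⁻¹ * t ^ (k - i)) := by
  let ρ : ℕ → ℝ := fun i => Nat.rec ρ₀ (fun j r => a * r + b * t ^ (k - (j + 1))) i
  have hρ0 : ρ 0 = ρ₀ := rfl
  have hρs : ∀ j, ρ (j + 1) = a * ρ j + b * t ^ (k - (j + 1)) := fun j => rfl
  have hρnn : ∀ i, 0 ≤ ρ i := by
    intro i
    induction i with
    | zero => rw [hρ0]; exact hρ₀
    | succ j ih => rw [hρs]; positivity
  have hinv := recursion_geometric_source_init_invariant ha hb ht hat k ρ (fun j _ => (hρs j).le)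
  have hH : ∀ i, i ≤ k → H i (ρ i) := by
    intro i
    induction i with
    | zero => intro _; rw [hρ0]; exact h0
    | succ j ih =>
        intro hj
        have hj' : j < k := Nat.lt_of_succ_le hj
        rw [hρs]
        exact hstep j hj' (ρ j) (hρnn j) (ih hj'.le)
  intro i hi
  have hle := hinv i hi
  rw [hρ0] at hle
  exact hmono i (ρ i) _ (hH i hi) hle

/-- §5 ★ **TOWER FROM STEP with an initial datum, top level**: `H k (aᵏ·ρ₀ + b·(1 − a·t)⁻¹)`. [cite: Balaban1985Averaging, Prop. 4 p.38, (139)-(144) pp.39-40] -/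
theorem tower_of_step_init_top (H : ℕ → ℝ → Prop) (hmono : ∀ j ρ ρ', H j ρ → ρ ≤ ρ' → H j ρ') {a b t ρ₀ : ℝ}
    (ha : 0 ≤ a) (hb : 0 ≤ b) (ht : 0 ≤ t) (hat : a * t < 1) (hρ₀ : 0 ≤ ρ₀) (k : ℕ) (h0 : H 0 ρ₀)
    (hstep : ∀ j, j < k → ∀ ρ, 0 ≤ ρ → H j ρ → H (j + 1) (a * ρ + b * t ^ (k - (j + 1)))) :
    H k (a ^ k * ρ₀ + b * (1 - a * t)⁻¹) := by
  have h := tower_of_step_init_level H hmono ha hb ht hat hρ₀ k h0 hstep k le_rfl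
  rwa [Nat.sub_self, pow_zero, mul_one] at h

end Summit.QuantumFields.YangMills.Theorems.HalvingBalLevelRecursion
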